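import Summits.BirchSwinnertonDyer.BirchSwinnertonDyer.Theorems.KimAtThreeDeepLowerLevelLoweringFibers
import HarnessLib

/-!
# Route `KimAtThreeKolyvagin` (rung W2), crux `DeepLowerAtThreeOffKatoStratum` (item 19679): «Tamagawa
# divisibility of Kurihara numbers» via LEVEL LOWERING — part 2/3: the proper partial Kurihara sums of a
# Hecke-`2` symbol VANISH, and the Kurihara sums of a `q`-stabilised symbol vanish

Cell `bsd-addord`, seat `bsd-addord-w2-c2` (gen 4, owner of `stmt-BirchSwinnertonDyer-19679`). Continues
`KimAtThreeDeepLowerLevelLoweringFibers` (notation there): pure algebra over a commutative ring `R`, for a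
`1`-periodic `φ : ℚ → R`, Hecke with eigenvalue `2` at the primes of a square-free `n`, and `ℓ`-periodic additive
characters `χ_ℓ` on the units.

* `partialSum_eq_of_mul_prime` — removing one prime: for `n = Nℓ`,
  `S_T(n) = 2 S_T(N) − ∑_c φ(c̃/N)(w_T((ℓ⁻¹c)~) + w_T((ℓc)~))` (CRT fibre + Hecke, part 1).
* `partialSum_eq_zero_of_ssubset` — **every PROPER partial sum vanishes**: `S_T(n) = 0` for `T ⊊ primes(n)`
  (strong induction on `n`: the two twisted sums are `S_T(N)` each once the proper sums at level `N` vanish).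
  These are the lower Taylor coefficients of the Mazur–Tate element `θ_n = ∑_a φ(ã/n) σ_a` — Ota 2018
  Prop. 2.3 (1) / Kim 2022 §3.5 ("`θ_{ℚ(μ_n)} ≡ δ̃_n ∏(σ_{η_ℓ} − 1) mod …`"), here from the Hecke relation alone.
* `kuriharaSum_stabilised_eq_zero` — **for `q` prime to `n` the full Kurihara sum of the `q`-stabilised symbol
  `x ↦ φ(x) − φ(qx)` is `0`**: `∑_{a∈(ℤ/n)ˣ} (φ(ã/n) − φ(qã/n)) ∏_{ℓ∣n} χ_ℓ(ã) = 0` (substitute `a ↦ q⁻¹a`; the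
  difference is a combination of proper partial sums). In Mazur–Tate terms: `θ_n(φ − φ∘q) = (1 − σ_q⁻¹)θ_n(φ)`
  lies one step deeper in the augmentation filtration, so its top Taylor coefficient — the Kurihara number —
  dies. This is the algebra of «`f ≡ g_α (mod p^m)` with `g_α = g − g|V_q` the `q`-stabilisation at a prime
  where `a_q(f) = 1` (split multiplicative `q`, or `q` of type IV/IV* with `c_q = 3` at `p = 3`) ⟹ every
  Kurihara number of `f` vanishes mod `p^m`» (part 3).

HONEST FRAMING. Theorems only; unconditional finite algebra; no definition, no named fact, no `sorry`; crux
19679 stays OPEN; BSD is not proved by any of this.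

References: [Ota2018] Prop. 2.3 (1), Prop. 3.3, §5.1; [Kurihara2014] §1.1; [MazurTateTeitelbaum1986Invent]
§I.4 (4.2); [Kim2022StructureSelmer] §3.5, Conj. 1.10; [Kim2025RefinedTNC] §8.1.2; [Ribet1990] Thm. 1.1.
-/

set_option autoImplicit false
-- the Theorems namespace of a single-conjunct summit repeats the summit name by design (D-0017)
set_option linter.dupNamespace false

noncomputable section

open scoped BigOperators Classical

namespace Summit.BirchSwinnertonDyer.BirchSwinnertonDyer.Theorems.KimAtThreeDeepLowerLevelLoweringSums

open Summit.BirchSwinnertonDyer.BirchSwinnertonDyer.Theorems.KimAtThreeDeepLowerLevelLoweringFibers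

section Abstract

variable {R : Type*} [CommRing R] {φ : ℚ → R} {χ : ℕ → ℕ → R}

/-! ### §1.4 The recursion `S_T(Nℓ) = 2 S_T(N) − (two twisted sums)` and the vanishing of proper partial sums -/

/-- **Removing one prime**: for `n = N ℓ` with `ℓ` a prime not dividing `N` at which `φ` is Hecke with
eigenvalue `2`, and `T` a set of primes dividing `N` carrying `ℓ'`-periodic characters,
`S_T(n) = 2 S_T(N) − ∑_c φ(c̃/N) (w_T((ℓ⁻¹c)~) + w_T((ℓc)~))` — the classes over a unit `b` mod `N` are
`B + N j` minus the one divisible by `ℓ`, and `∑_j φ((B + N j)/n) = 2φ(B/N) − φ(ℓB/N)`.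
[cite: Ota2018, Prop. 2.3 (1) and Prop. 3.3] [cite: MazurTateTeitelbaum1986Invent, §I.4 (4.2)] -/
theorem partialSum_eq_of_mul_prime {n N ℓ : ℕ} [NeZero n] [NeZero N] [Fact ℓ.Prime] (hn : n = N * ℓ)
    (h : N.Coprime ℓ) (hper : ∀ x, φ (x + 1) = φ x)
    (hH : ∀ x : ℚ, 2 * φ x = (∑ j : Fin ℓ, φ ((x + j) / ℓ)) + φ (ℓ * x))
    (T : Finset ℕ) (hχ : ∀ ℓ' ∈ T, ∀ a, χ ℓ' (a + ℓ') = χ ℓ' a) (hT : ∀ ℓ' ∈ T, ℓ' ∣ N) :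
    ∑ a : (ZMod n)ˣ, φ (((a : ZMod n).val : ℚ) / n) * ∏ ℓ' ∈ T, χ ℓ' (a : ZMod n).val =
      2 * (∑ c : (ZMod N)ˣ, φ (((c : ZMod N).val : ℚ) / N) * ∏ ℓ' ∈ T, χ ℓ' (c : ZMod N).val) -
        ∑ c : (ZMod N)ˣ, φ (((c : ZMod N).val : ℚ) / N) *
          ((∏ ℓ' ∈ T, χ ℓ' (((ZMod.unitOfCoprime ℓ h.symm)⁻¹ * c : (ZMod N)ˣ) : ZMod N).val) +
            ∏ ℓ' ∈ T, χ ℓ' ((ZMod.unitOfCoprime ℓ h.symm * c : (ZMod N)ˣ) : ZMod N).val) := by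
  subst hn
  have hℓ : ℓ.Prime := Fact.out
  set e := ZMod.chineseRemainder h with he
  set E : (ZMod (N * ℓ))ˣ ≃* (ZMod N)ˣ × (ZMod ℓ)ˣ :=
    (Units.mapEquiv e.toMulEquiv).trans MulEquiv.prodUnits with hE
  set lu : (ZMod N)ˣ := ZMod.unitOfCoprime ℓ h.symm with hlu
  set F : (ZMod (N * ℓ))ˣ → R := fun a =>
    φ (((a : ZMod (N * ℓ)).val : ℚ) / (N * ℓ : ℕ)) * ∏ ℓ' ∈ T, χ ℓ' (a : ZMod (N * ℓ)).val with hF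
  -- reindex the unit sum through CRT on units
  have hre : ∑ a : (ZMod (N * ℓ))ˣ, F a = ∑ b : (ZMod N)ˣ, ∑ c : (ZMod ℓ)ˣ, F (E.symm (b, c)) := by
    rw [← Equiv.sum_comp E.symm.toEquiv F, Fintype.sum_prod_type]
    rfl
  change ∑ a : (ZMod (N * ℓ))ˣ, F a = _
  rw [hre]
  -- in the fibre over `b` the weight is `w_T(b̃)` and the class is `CRT⁻¹(b, c)`
  have hcoe : ∀ (b : (ZMod N)ˣ) (c : (ZMod ℓ)ˣ),
      ((E.symm (b, c) : (ZMod (N * ℓ))ˣ) : ZMod (N * ℓ)) = e.symm ((b : ZMod N), (c : ZMod ℓ)) :=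
    fun b c => rfl
  have hmod : ∀ (b : (ZMod N)ˣ) (c : (ZMod ℓ)ˣ),
      ((E.symm (b, c) : (ZMod (N * ℓ))ˣ) : ZMod (N * ℓ)).val ≡ (b : ZMod N).val [MOD N] := by
    intro b c
    rw [← ZMod.natCast_eq_natCast_iff, ZMod.natCast_zmod_val, hcoe,
      ← chineseRemainder_fst_eq_natCast_val h, ← he, RingEquiv.apply_symm_apply]
  have hfib : ∀ b : (ZMod N)ˣ, ∑ c : (ZMod ℓ)ˣ, F (E.symm (b, c)) =
      (∏ ℓ' ∈ T, χ ℓ' (b : ZMod N).val) *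
        (2 * φ (((b : ZMod N).val : ℚ) / N) - φ ((((lu * b : (ZMod N)ˣ) : ZMod N).val : ℚ) / N) -
          φ ((((lu⁻¹ * b : (ZMod N)ˣ) : ZMod N).val : ℚ) / N)) := by
    intro b
    have hF' : ∀ c : (ZMod ℓ)ˣ, F (E.symm (b, c)) =
        (∏ ℓ' ∈ T, χ ℓ' (b : ZMod N).val) *
          φ (((e.symm ((b : ZMod N), (c : ZMod ℓ))).val : ℚ) / (N * ℓ : ℕ)) := by
      intro c
      simp only [hF]
      rw [prod_chi_eq_of_modEq T hχ hT (hmod b c), hcoe, mul_comm]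
    simp only [hF']
    rw [← Finset.mul_sum, sum_units_zmod_prime (fun x : ZMod ℓ =>
      φ (((e.symm ((b : ZMod N), x)).val : ℚ) / (N * ℓ : ℕ))), he,
      sum_fiber_eq_of_hecke h hper hH, apply_fiber_zero h hper]
    congr 1
    have h1 : φ (((ℓ * (b : ZMod N).val : ℕ) : ℚ) / N) =
        φ ((((lu * b : (ZMod N)ˣ) : ZMod N).val : ℚ) / N) := by
      refine (apply_val_div_eq hper N ?_).symm
      push_cast
      rw [ZMod.natCast_zmod_val, hlu, ZMod.coe_unitOfCoprime]
    rw [h1, Units.val_mul, Units.val_mul]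
  simp only [hfib]
  -- reassemble: substitute `b = ℓ⁻¹ c`, `b = ℓ c` in the two subtracted sums
  have hsub1 : ∑ b : (ZMod N)ˣ, (∏ ℓ' ∈ T, χ ℓ' (b : ZMod N).val) *
      φ ((((lu * b : (ZMod N)ˣ) : ZMod N).val : ℚ) / N) =
      ∑ c : (ZMod N)ˣ, φ (((c : ZMod N).val : ℚ) / N) *
        ∏ ℓ' ∈ T, χ ℓ' ((lu⁻¹ * c : (ZMod N)ˣ) : ZMod N).val := by
    rw [← Equiv.sum_comp (Equiv.mulLeft lu⁻¹)]
    refine Finset.sum_congr rfl fun c _ => ?_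
    simp only [Equiv.coe_mulLeft, mul_inv_cancel_left]
    ring
  have hsub2 : ∑ b : (ZMod N)ˣ, (∏ ℓ' ∈ T, χ ℓ' (b : ZMod N).val) *
      φ ((((lu⁻¹ * b : (ZMod N)ˣ) : ZMod N).val : ℚ) / N) =
      ∑ c : (ZMod N)ˣ, φ (((c : ZMod N).val : ℚ) / N) *
        ∏ ℓ' ∈ T, χ ℓ' ((lu * c : (ZMod N)ˣ) : ZMod N).val := by
    rw [← Equiv.sum_comp (Equiv.mulLeft lu)]
    refine Finset.sum_congr rfl fun c _ => ?_
    simp only [Equiv.coe_mulLeft, inv_mul_cancel_left]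
    ring
  have hsplit : ∑ b : (ZMod N)ˣ, (∏ ℓ' ∈ T, χ ℓ' (b : ZMod N).val) *
      (2 * φ (((b : ZMod N).val : ℚ) / N) - φ ((((lu * b : (ZMod N)ˣ) : ZMod N).val : ℚ) / N) -
        φ ((((lu⁻¹ * b : (ZMod N)ˣ) : ZMod N).val : ℚ) / N)) =
      2 * (∑ c : (ZMod N)ˣ, φ (((c : ZMod N).val : ℚ) / N) * ∏ ℓ' ∈ T, χ ℓ' (c : ZMod N).val) -
        ∑ b : (ZMod N)ˣ, (∏ ℓ' ∈ T, χ ℓ' (b : ZMod N).val) *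
          φ ((((lu * b : (ZMod N)ˣ) : ZMod N).val : ℚ) / N) -
        ∑ b : (ZMod N)ˣ, (∏ ℓ' ∈ T, χ ℓ' (b : ZMod N).val) *
          φ ((((lu⁻¹ * b : (ZMod N)ˣ) : ZMod N).val : ℚ) / N) := by
    rw [Finset.mul_sum, ← Finset.sum_sub_distrib, ← Finset.sum_sub_distrib]
    refine Finset.sum_congr rfl fun b _ => ?_
    ring
  rw [hsplit, hsub1, hsub2]
  simp only [mul_add, Finset.sum_add_distrib]
  ring

/-- **The PROPER partial Kurihara sums vanish** (lower Taylor coefficients of the Mazur–Tate element at a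
square-free level all of whose primes are Hecke-`2` for `φ`): for `n` square-free, `φ` `1`-periodic and
Hecke with eigenvalue `2` at every prime of `n`, `χ_ℓ` `ℓ`-periodic and logarithmic on units at every prime
`ℓ ∣ n`, and `T ⊊ primes(n)`: `S_T(n) = ∑_{a ∈ (ℤ/n)ˣ} φ(ã/n) ∏_{ℓ ∈ T} χ_ℓ(ã) = 0`.
[cite: Ota2018, Prop. 2.3 (1) and Prop. 3.3] [cite: Kim2022StructureSelmer, §3.5 (PDF p. 19)] -/
theorem partialSum_eq_zero_of_ssubset (hper : ∀ x, φ (x + 1) = φ x) :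
    ∀ (n : ℕ) [NeZero n], Squarefree n →
      (∀ ℓ ∈ n.primeFactors, ∀ x : ℚ, 2 * φ x = (∑ j : Fin ℓ, φ ((x + j) / ℓ)) + φ (ℓ * x)) →
      (∀ ℓ ∈ n.primeFactors, ∀ a, χ ℓ (a + ℓ) = χ ℓ a) →
      (∀ ℓ ∈ n.primeFactors, ∀ a b : ℕ, a.Coprime ℓ → b.Coprime ℓ → χ ℓ (a * b) = χ ℓ a + χ ℓ b) →
      ∀ T : Finset ℕ, T ⊂ n.primeFactors →
        ∑ a : (ZMod n)ˣ, φ (((a : ZMod n).val : ℚ) / n) * ∏ ℓ ∈ T, χ ℓ (a : ZMod n).val = 0 := by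
  intro n
  induction n using Nat.strong_induction_on with
  | _ n ih =>
    intro _ hsq hH hχ hlog T hT
    obtain ⟨ℓ, hℓP, hℓT⟩ := Finset.exists_of_ssubset hT
    have hn0 : n ≠ 0 := NeZero.ne n
    have hℓ : ℓ.Prime := Nat.prime_of_mem_primeFactors hℓP
    have hℓn : ℓ ∣ n := Nat.dvd_of_mem_primeFactors hℓP
    haveI : Fact ℓ.Prime := ⟨hℓ⟩
    set N := n / ℓ with hN
    have hnN : n = N * ℓ := (Nat.div_mul_cancel hℓn).symm
    have hN0 : N ≠ 0 := fun h0 => hn0 (by rw [hnN, h0, zero_mul])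
    haveI : NeZero N := ⟨hN0⟩
    have hNn : N ∣ n := ⟨ℓ, hnN⟩
    have hcop : N.Coprime ℓ := by
      rw [Nat.coprime_comm, hℓ.coprime_iff_not_dvd]
      rintro ⟨m, hm⟩
      have : ℓ * ℓ ∣ n := ⟨m, by rw [hnN, hm]; ring⟩
      exact hℓ.one_lt.ne' (Nat.isUnit_iff.mp (hsq ℓ this))
    have hTN : ∀ ℓ' ∈ T, ℓ' ∣ N := by
      intro ℓ' hℓ'
      have hℓ'P := hT.1 hℓ'
      have hℓ'p : ℓ'.Prime := Nat.prime_of_mem_primeFactors hℓ'P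
      have hne : ℓ' ≠ ℓ := fun he => hℓT (he ▸ hℓ')
      exact ((Nat.coprime_primes hℓ'p hℓ).mpr hne).dvd_of_dvd_mul_right
        (hnN ▸ Nat.dvd_of_mem_primeFactors hℓ'P)
    have hTsub : T ⊆ N.primeFactors := fun ℓ' hℓ' =>
      Nat.mem_primeFactors.mpr ⟨Nat.prime_of_mem_primeFactors (hT.1 hℓ'), hTN ℓ' hℓ', hN0⟩
    have hPN : N.primeFactors ⊆ n.primeFactors := Nat.primeFactors_mono hNn hn0
    -- induction hypothesis at level `N < n`: every proper partial sum of every `U ⊊ T` vanishes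
    have hvan : ∀ U, U ⊂ T →
        ∑ c : (ZMod N)ˣ, φ (((c : ZMod N).val : ℚ) / N) * ∏ ℓ' ∈ U, χ ℓ' (c : ZMod N).val = 0 :=
      fun U hU => ih N (hnN ▸ (Nat.div_lt_self (Nat.pos_of_ne_zero hn0) hℓ.one_lt |> fun h' => by
          rw [← hN] at h'; exact hnN ▸ h' )) (hsq.squarefree_of_dvd hNn)
        (fun ℓ' hℓ' => hH ℓ' (hPN hℓ')) (fun ℓ' hℓ' => hχ ℓ' (hPN hℓ'))
        (fun ℓ' hℓ' => hlog ℓ' (hPN hℓ')) U (Finset.ssubset_of_ssubset_of_subset hU hTsub)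
    rw [partialSum_eq_of_mul_prime hnN hcop hper (hH ℓ hℓP) T (fun ℓ' hℓ' => hχ ℓ' (hT.1 hℓ')) hTN,
      Finset.sum_congr rfl fun c _ => mul_add _ _ _, Finset.sum_add_distrib,
      sum_mul_prod_chi_mul_of_forall_ssubset N T (fun ℓ' hℓ' => hχ ℓ' (hT.1 hℓ'))
        (fun ℓ' hℓ' => hlog ℓ' (hT.1 hℓ')) hTN _ hvan,
      sum_mul_prod_chi_mul_of_forall_ssubset N T (fun ℓ' hℓ' => hχ ℓ' (hT.1 hℓ'))
        (fun ℓ' hℓ' => hlog ℓ' (hT.1 hℓ')) hTN _ hvan]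
    ring

/-! ### §1.5 Corollary: the Kurihara sums of a `q`-stabilised symbol `x ↦ φ(x) − φ(qx)` vanish -/

/-- **Kurihara sums of a stabilised symbol vanish.** Under the hypotheses of
`partialSum_eq_zero_of_ssubset`, for every `q` prime to `n` the FULL Kurihara sum of the `q`-stabilised
symbol `x ↦ φ(x) − φ(q x)` vanishes: `∑_{a ∈ (ℤ/n)ˣ} (φ(ã/n) − φ(qã/n)) ∏_{ℓ ∣ n} χ_ℓ(ã) = 0` — substituting
`a ↦ q⁻¹a` in the second sum turns it into the twisted sum `∑_c φ(c̃/n) w(q⁻¹c)`, which equals the first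
by the vanishing of the proper partial sums. This is the algebra of «`[x]⁺_f ≡ u([x]⁺_g − [qx]⁺_g)` ⟹ every
Kurihara number of `f` vanishes». [cite: Ota2018, Prop. 2.3 (1) and Prop. 3.3]
[cite: Kim2025RefinedTNC, §8.1.2 (the Tamagawa-3 example 20787.e1: "δ̃_n vanishes mod 3 for every n ∈ 𝒩₁")] -/
theorem kuriharaSum_stabilised_eq_zero (hper : ∀ x, φ (x + 1) = φ x) (n : ℕ) [NeZero n]
    (hsq : Squarefree n)
    (hH : ∀ ℓ ∈ n.primeFactors, ∀ x : ℚ, 2 * φ x = (∑ j : Fin ℓ, φ ((x + j) / ℓ)) + φ (ℓ * x))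
    (hχ : ∀ ℓ ∈ n.primeFactors, ∀ a, χ ℓ (a + ℓ) = χ ℓ a)
    (hlog : ∀ ℓ ∈ n.primeFactors, ∀ a b : ℕ, a.Coprime ℓ → b.Coprime ℓ → χ ℓ (a * b) = χ ℓ a + χ ℓ b)
    {q : ℕ} (hq : q.Coprime n) :
    ∑ a : (ZMod n)ˣ, (φ (((a : ZMod n).val : ℚ) / n) - φ ((q : ℚ) * (a : ZMod n).val / n)) *
      ∏ ℓ ∈ n.primeFactors, χ ℓ (a : ZMod n).val = 0 := by
  set qu : (ZMod n)ˣ := ZMod.unitOfCoprime q hq with hqu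
  have hP : ∀ ℓ ∈ n.primeFactors, ℓ ∣ n := fun ℓ hℓ => Nat.dvd_of_mem_primeFactors hℓ
  -- the second sum is the twisted sum at `u = q⁻¹`
  have h2 : ∑ a : (ZMod n)ˣ, φ ((q : ℚ) * (a : ZMod n).val / n) *
      ∏ ℓ ∈ n.primeFactors, χ ℓ (a : ZMod n).val =
      ∑ c : (ZMod n)ˣ, φ (((c : ZMod n).val : ℚ) / n) *
        ∏ ℓ ∈ n.primeFactors, χ ℓ ((qu⁻¹ * c : (ZMod n)ˣ) : ZMod n).val := by
    rw [← Equiv.sum_comp (Equiv.mulLeft qu⁻¹)]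
    refine Finset.sum_congr rfl fun c _ => ?_
    simp only [Equiv.coe_mulLeft]
    congr 1
    rw [show (q : ℚ) * (((qu⁻¹ * c : (ZMod n)ˣ) : ZMod n).val : ℚ) / n =
      ((q * ((qu⁻¹ * c : (ZMod n)ˣ) : ZMod n).val : ℕ) : ℚ) / n by push_cast; ring]
    refine (apply_val_div_eq hper n ?_).symm
    calc ((q * ((qu⁻¹ * c : (ZMod n)ˣ) : ZMod n).val : ℕ) : ZMod n)
        = (q : ZMod n) * ((qu⁻¹ * c : (ZMod n)ˣ) : ZMod n) := by
          rw [Nat.cast_mul, ZMod.natCast_zmod_val]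
      _ = (qu : ZMod n) * ((qu⁻¹ * c : (ZMod n)ˣ) : ZMod n) := by rw [hqu, ZMod.coe_unitOfCoprime]
      _ = ((qu * (qu⁻¹ * c) : (ZMod n)ˣ) : ZMod n) := (Units.val_mul _ _).symm
      _ = (c : ZMod n) := by rw [mul_inv_cancel_left]
  rw [Finset.sum_congr rfl fun a _ => sub_mul _ _ _, Finset.sum_sub_distrib, h2,
    sum_mul_prod_chi_mul_of_forall_ssubset n n.primeFactors hχ hlog hP qu⁻¹
      (partialSum_eq_zero_of_ssubset hper n hsq hH hχ hlog), sub_self]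

end Abstract

end Summit.BirchSwinnertonDyer.BirchSwinnertonDyer.Theorems.KimAtThreeDeepLowerLevelLoweringSums

end
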